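import Literature.MathematicalPhysics.QuantumManyBody.BoseGasTopFaceCutoff
import Literature.MathematicalPhysics.QuantumManyBody.BoseGasTrialStateCompactness
import Literature.MathematicalPhysics.QuantumManyBody.BoseGasThermodynamicLimitProofs
import HarnessLib

/-!
# Right-continuity of the Dirichlet ground-state energy in the side of the box

Topic `Literature/MathematicalPhysics/QuantumManyBody`, grouping namespace `BoseGas` (sub-namespace
`RightContinuity` for the lemmas), over `groundStateEnergy v N L` of `BoseEinsteinCondensation.lean`
(the infimum of `⟨Ψ, H_N Ψ⟩` over the symmetric `C¹` Dirichlet trial states of `Λ_L^N`,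
`H_N = -∑Δᵢ + ∑_{i<j} v(|xᵢ - xⱼ|)`, `v : ℝ → [0, ∞]` ARBITRARY — hard cores and non-measurable
profiles included).

* `groundStateEnergy_le_iSup_enlarge` — **no downward jump from the right**:
  `E₀(N, L) ≤ supₙ E₀(N, L + 1/(n+1))` (`L > 0`, `E₀(N, L) < ∞`);
* `groundStateEnergy_rightContinuous` — the `ε`-form: for every `η > 0` there is `w₀ > 0` with
  `E₀(N, L) ≤ E₀(N, L + w) + η` for all `0 < w < w₀` (the map `L ↦ E₀(N, L)` is non-increasing,
  `groundStateEnergy_anti`, so this is right-continuity at `L`).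

## Proof (variational, by compactness; no regularity, no density theorem)

Take near-minimisers `Φₙ` of the boxes `Λ_{L+1/(n+1)}`. Their kinetic energies are bounded, so by the
Rellich–Kondrachov theorem for trial states (`BoxFace.exists_subseq_tendsto_of_trialStates`, from the
tree's `C¹`-core compactness theorem) a subsequence converges in `L²` and a.e. to some `f`. Hardy's
inequality at the top faces of the boxes `Λ_{L+wₙ}` and Fatou give
`∫_{x_p<L} |f|²/(L - x_p)² ≤ 4(E₀(L)+1)` for every coordinate `p`, and `f = 0` a.e. above `L`
(`BoxFace.lintegral_sq_div_sq_limit_le`, `BoxFace.ae_eq_zero_of_tendsto_face`); hence the mass of `f`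
in the collars `{L - h < x_p}` is `o(h²)` (dominated convergence). Cutting `Φₙ` down to `Λ_L` with the
product cut-off of `BoseGasTopFaceCutoff` (`TopFaceCutoff.groundStateEnergy_mul_le`) gives
`E₀(L)(1 - mₙ(h)) ≤ (1+α)⟨Φₙ,HΦₙ⟩ + (1+α⁻¹)(π/2h)² mₙ(h)` with the collar masses `mₙ(h)` of `Φₙ`, which
converge to those of `f` by STRONG `L²` convergence (`BoxFace.tendsto_setLIntegral_sq`) — the kinetic
energy that `Φₙ` may concentrate at the wall is dropped, not paid for, and the interaction only enters
through `χ ≤ 1`. Letting `n → ∞`, then `h → 0`, then `α → 0` gives `E₀(L) ≤ supₙ E₀(L + 1/(n+1))`.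

Standard material (continuity of Dirichlet eigenvalues under domain perturbation, here for the
many-body form with an arbitrary repulsive pair interaction); tagged folklore. Not here: left
continuity (elementary, by interior cut-off), rates, the thermodynamic limit.

## References

* [LSSY2005] E. H. Lieb, R. Seiringer, J. P. Solovej, J. Yngvason, *The Mathematics of the Bose Gas
  and its Condensation* (2005), Ch. 2 (the Dirichlet boxes `E₀(N, L)`, (2.3)).
* L. C. Evans, *Partial Differential Equations*, 2nd ed. (2010), §5.7 (Rellich–Kondrachov).
-/

noncomputable section

namespace Literature.MathematicalPhysics.QuantumManyBody.BoseGas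

open _root_.MeasureTheory _root_.Filter _root_.Set
open scoped ENNReal NNReal Topology

namespace RightContinuity

variable {N : ℕ}

/-! ### Elementary limits -/

/-- `1/(n+1) → 0`, `0 < 1/(n+1) ≤ 1`. [folklore] -/
theorem seq_facts : Tendsto (fun n : ℕ => 1 / ((n : ℝ) + 1)) atTop (𝓝 0) ∧
    (∀ n : ℕ, 0 < 1 / ((n : ℝ) + 1)) ∧ ∀ n : ℕ, 1 / ((n : ℝ) + 1) ≤ 1 :=
  ⟨tendsto_one_div_add_atTop_nhds_zero_nat, fun n => by positivity, fun n => by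
    rw [div_le_one (by positivity)]; linarith [(Nat.cast_nonneg n : (0 : ℝ) ≤ n)]⟩

/-- A single directional derivative is bounded by the kinetic density. [folklore] -/
theorem enorm_fderiv_single_sq_le (ψ : Config N → ℂ) (X : Config N) (p : Fin N × Fin 3) :
    ‖fderiv ℝ ψ X (Pi.single p.1 (EuclideanSpace.single p.2 (1 : ℝ)))‖ₑ ^ 2 ≤ kineticDensity ψ X := by
  unfold kineticDensity
  refine le_trans ?_ (Finset.single_le_sum (f := fun i => ∑ k : Fin 3,
    ((‖fderiv ℝ ψ X (Pi.single i (EuclideanSpace.single k (1 : ℝ)))‖₊ : ℝ≥0∞)) ^ 2)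
    (fun _ _ => zero_le) (Finset.mem_univ p.1))
  exact Finset.single_le_sum (f := fun k : Fin 3 =>
    ((‖fderiv ℝ ψ X (Pi.single p.1 (EuclideanSpace.single k (1 : ℝ)))‖₊ : ℝ≥0∞)) ^ 2)
    (fun _ _ => zero_le) (Finset.mem_univ p.2)

/-! ### The collar masses of the limit are `o(h²)` -/

/-- **Collar masses of the limit.** If `f` vanishes a.e. above `L` in every coordinate and obeys the
weighted bounds `∫_{-1<x_p<L} |f|²/(L - x_p)² ≤ K < ∞`, then with `h_j = 1/(j+1)` the collar masses
satisfy `∑_{i,k} ∫_{x_{i,k} > L - h_j} |f|² ≤ h_j² δ_j` with `δ_j → 0` (split off the null hyperplane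
and the region above `L`; on the collar `1 ≤ h²/(L-x)²`; continuity from above of the finite measures
`|f|²/(L-x_p)² dX`). [folklore] -/
theorem collar_mass_le {f : Config N → ℂ} {L : ℝ} (hL : 0 < L)
    (hzero : ∀ p : Fin N × Fin 3, ∀ᵐ X : Config N, L < X p.1 p.2 → f X = 0) {K : ℝ≥0∞} (hK : K ≠ ⊤)
    (hW : ∀ p : Fin N × Fin 3, ∫⁻ X in {X : Config N | X p.1 p.2 ∈ Ioo (L - (L + 1)) L},
      ‖f X‖ₑ ^ 2 / ENNReal.ofReal ((L - X p.1 p.2) ^ 2) ≤ K) :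
    ∃ δ : ℕ → ℝ≥0∞, Tendsto δ atTop (𝓝 0) ∧ ∀ j : ℕ,
      ∑ i : Fin N, ∑ k : Fin 3, ∫⁻ X in {X : Config N | L - 1 / ((j : ℝ) + 1) < X i k}, ‖f X‖ₑ ^ 2 ≤
        ENNReal.ofReal ((1 / ((j : ℝ) + 1)) ^ 2) *
          δ j := by
  obtain ⟨hh0, hhpos, hh1⟩ := seq_facts
  set hs : ℕ → ℝ := fun j => 1 / ((j : ℝ) + 1) with hhs
  -- the weights and the collars
  set W : Fin N × Fin 3 → Config N → ℝ≥0∞ := fun p X =>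
    ‖f X‖ₑ ^ 2 / ENNReal.ofReal ((L - X p.1 p.2) ^ 2) with hW_def
  set T : Fin N × Fin 3 → ℕ → Set (Config N) := fun p j =>
    {X : Config N | X p.1 p.2 ∈ Ioo (L - hs j) L} with hT_def
  have hTm : ∀ p j, MeasurableSet (T p j) := fun p j => BoxFace.measurableSet_slab p _ _
  set δ : ℕ → ℝ≥0∞ := fun j => ∑ p : Fin N × Fin 3, ∫⁻ X in T p j, W p X with hδ_def
  have hcoord : ∀ p : Fin N × Fin 3, Measurable fun X : Config N => X p.1 p.2 := fun p => by fun_prop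
  refine ⟨δ, ?_, fun j => ?_⟩
  · -- `δ_j → 0`: each term by continuity from above
    rw [show (0 : ℝ≥0∞) = ∑ p : Fin N × Fin 3, 0 by simp]
    refine tendsto_finsetSum _ fun p _ => ?_
    set ν : Measure (Config N) := volume.withDensity (W p) with hν
    have hanti : Antitone (T p) := by
      intro j j' hjj' X hX
      simp only [hT_def, mem_setOf_eq, mem_Ioo] at hX ⊢
      have : hs j' ≤ hs j := by
        simp only [hhs]
        exact one_div_le_one_div_of_le (by positivity) (by exact_mod_cast Nat.add_le_add_right hjj' 1)
      exact ⟨by linarith [hX.1], hX.2⟩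
    have hinter : ⋂ j, T p j = ∅ := by
      refine Set.eq_empty_of_forall_notMem fun X hX => ?_
      simp only [mem_iInter, hT_def, mem_setOf_eq, mem_Ioo] at hX
      have hlt : X p.1 p.2 < L := (hX 0).2
      obtain ⟨j, hj⟩ := (hh0.eventually (gt_mem_nhds (sub_pos.2 hlt))).exists
      linarith [(hX j).1]
    have hfin : ν (T p 0) ≠ ⊤ := by
      rw [hν, withDensity_apply _ (hTm p 0)]
      refine ne_top_of_le_ne_top hK ((lintegral_mono_set fun X hX => ?_).trans (hW p))
      simp only [hT_def, mem_setOf_eq, mem_Ioo] at hX ⊢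
      have h01 : hs 0 ≤ 1 := hh1 0
      exact ⟨by linarith [hX.1], hX.2⟩
    have hlim := tendsto_measure_iInter_atTop (μ := ν) (fun j => (hTm p j).nullMeasurableSet) hanti ⟨0, hfin⟩
    rw [hinter, measure_empty] at hlim
    refine hlim.congr fun j => ?_
    simp only [Function.comp_apply, hν, withDensity_apply _ (hTm p j)]
  · -- `∑ ∫_{collar} |f|² ≤ h_j² δ_j`
    rw [hδ_def, Finset.mul_sum, Fintype.sum_prod_type]
    refine Finset.sum_le_sum fun i _ => Finset.sum_le_sum fun k _ => ?_
    set p : Fin N × Fin 3 := (i, k) with hp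
    have hsplit : {X : Config N | L - hs j < X i k} ⊆
        T p j ∪ ({X : Config N | X p.1 p.2 = L} ∪ {X : Config N | L < X p.1 p.2}) := by
      intro X hX
      simp only [hT_def, mem_union, mem_setOf_eq, mem_Ioo, hp]
      rcases lt_trichotomy (X i k) L with h | h | h
      · exact Or.inl ⟨hX, h⟩
      · exact Or.inr (Or.inl h)
      · exact Or.inr (Or.inr h)
    have hnull : ∫⁻ X in {X : Config N | X p.1 p.2 = L}, ‖f X‖ₑ ^ 2 = 0 :=
      setLIntegral_measure_zero _ _ (BoxFace.volume_coord_eq_zero p L)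
    have habove : ∫⁻ X in {X : Config N | L < X p.1 p.2}, ‖f X‖ₑ ^ 2 = 0 := by
      have hS : MeasurableSet {X : Config N | L < X p.1 p.2} := measurableSet_lt measurable_const (hcoord p)
      rw [← lintegral_zero]
      refine lintegral_congr_ae ((ae_restrict_iff' hS).2 ?_)
      filter_upwards [hzero p] with X hX hXS
      rw [hX hXS, enorm_zero, zero_pow two_ne_zero]
    calc ∫⁻ X in {X : Config N | L - hs j < X i k}, ‖f X‖ₑ ^ 2
        ≤ ∫⁻ X in T p j ∪ ({X : Config N | X p.1 p.2 = L} ∪ {X : Config N | L < X p.1 p.2}), ‖f X‖ₑ ^ 2 :=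
          lintegral_mono_set hsplit
      _ ≤ (∫⁻ X in T p j, ‖f X‖ₑ ^ 2) + ((∫⁻ X in {X : Config N | X p.1 p.2 = L}, ‖f X‖ₑ ^ 2) +
            ∫⁻ X in {X : Config N | L < X p.1 p.2}, ‖f X‖ₑ ^ 2) :=
          (lintegral_union_le _ _ _).trans (add_le_add le_rfl (lintegral_union_le _ _ _))
      _ = ∫⁻ X in T p j, ‖f X‖ₑ ^ 2 := by rw [hnull, habove, add_zero, add_zero]
      _ ≤ ∫⁻ X in T p j, ENNReal.ofReal (hs j ^ 2) * W p X := by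
          refine setLIntegral_mono' (hTm p j) fun X hX => ?_
          simp only [hT_def, mem_setOf_eq, mem_Ioo] at hX
          have hb0 : ENNReal.ofReal ((L - X p.1 p.2) ^ 2) ≠ 0 :=
            (ENNReal.ofReal_pos.2 (by nlinarith [hX.2])).ne'
          have hle : ENNReal.ofReal ((L - X p.1 p.2) ^ 2) ≤ ENNReal.ofReal (hs j ^ 2) :=
            ENNReal.ofReal_le_ofReal (by nlinarith [hX.1, hX.2])
          calc ‖f X‖ₑ ^ 2 = ‖f X‖ₑ ^ 2 / ENNReal.ofReal ((L - X p.1 p.2) ^ 2) *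
                ENNReal.ofReal ((L - X p.1 p.2) ^ 2) := (ENNReal.div_mul_cancel hb0 ENNReal.ofReal_ne_top).symm
            _ ≤ W p X * ENNReal.ofReal (hs j ^ 2) := mul_le_mul_right hle _
            _ = _ := mul_comm _ _
      _ = ENNReal.ofReal (hs j ^ 2) * ∫⁻ X in T p j, W p X :=
          lintegral_const_mul' _ _ ENNReal.ofReal_ne_top

/-! ### Near-minimisers -/

/-- A box with finite ground-state energy has trial states of energy `≤ E₀ + ε` for every `ε > 0`.
[folklore] -/
theorem exists_nearMin (v : ℝ → ℝ≥0∞) (N : ℕ) {L' : ℝ} (hfin : groundStateEnergy v N L' ≠ ⊤)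
    {ε : ℝ≥0∞} (hε : ε ≠ 0) :
    ∃ Φ : TrialState N L', energy v Φ ≤ groundStateEnergy v N L' + ε := by
  have hlt : groundStateEnergy v N L' < groundStateEnergy v N L' + ε := ENNReal.lt_add_right hfin hε
  obtain ⟨Φ, hΦ⟩ := iInf_lt_iff.1 hlt
  exact ⟨Φ, hΦ.le⟩

end RightContinuity

open RightContinuity in
/-- **No downward jump of the Dirichlet ground-state energy from the right.** For every pair
potential `v : ℝ → [0, ∞]`, every `N`, and every `L > 0` with `E₀(N, L) < ∞`:
`E₀(N, L) ≤ supₙ E₀(N, L + 1/(n+1))`. Variational proof by compactness (near-minimisers of the larger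
boxes, Rellich–Kondrachov, Hardy at the top faces and Fatou for the limit, product cut-off of the
near-minimisers with the collar masses controlled by strong `L²` convergence); see the module
docstring. [folklore] -/
theorem groundStateEnergy_le_iSup_enlarge (v : ℝ → ℝ≥0∞) (N : ℕ) {L : ℝ} (hL : 0 < L)
    (hfin : groundStateEnergy v N L ≠ ⊤) :
    groundStateEnergy v N L ≤ ⨆ n : ℕ, groundStateEnergy v N (L + 1 / ((n : ℝ) + 1)) := by
  obtain ⟨hw0, hwpos, hw1⟩ := seq_facts
  set w : ℕ → ℝ := fun n => 1 / ((n : ℝ) + 1) with hw_def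
  set E₀ := groundStateEnergy v N L with hE₀
  set E : ℕ → ℝ≥0∞ := fun n => groundStateEnergy v N (L + w n) with hE_def
  change E₀ ≤ ⨆ n, E n
  set Esup := ⨆ n, E n with hEsup
  have hEle : ∀ n, E n ≤ E₀ := fun n => groundStateEnergy_anti v N (by linarith [hwpos n])
  have hEtop : ∀ n, E n ≠ ⊤ := fun n => ne_top_of_le_ne_top hfin (hEle n)
  have hEmono : Monotone E := by
    intro n n' hnn'
    refine groundStateEnergy_anti v N ?_
    have : w n' ≤ w n :=
      one_div_le_one_div_of_le (by positivity) (by exact_mod_cast Nat.add_le_add_right hnn' 1)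
    linarith
  have hEtend : Tendsto E atTop (𝓝 Esup) := tendsto_atTop_iSup hEmono
  -- near-minimisers of the larger boxes
  have hex : ∀ n, ∃ Φ : TrialState N (L + w n), energy v Φ ≤ E n + ENNReal.ofReal (w n) := fun n =>
    exists_nearMin v N (hEtop n) (ENNReal.ofReal_pos.2 (hwpos n)).ne'
  choose Φ hΦ using hex
  set K : ℝ≥0∞ := E₀ + 1 with hK
  have hKtop : K ≠ ⊤ := ENNReal.add_ne_top.2 ⟨hfin, ENNReal.one_ne_top⟩
  have henergy_le : ∀ n, energy v (Φ n) ≤ K := fun n =>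
    (hΦ n).trans (add_le_add (hEle n) (ENNReal.ofReal_le_one.2 (hw1 n)))
  have hkin : ∀ n, ∫⁻ X, kineticDensity (Φ n).ψ X ≤ K := fun n =>
    (lintegral_mono fun X => le_self_add).trans (henergy_le n)
  -- Rellich: an `L²`- and a.e.-convergent subsequence
  obtain ⟨f, κ, hκ, hf, hL2, hae⟩ := BoxFace.exists_subseq_tendsto_of_trialStates (fun n => L + w n)
    (Lbar := L + 1) (fun n => by linarith [hwpos n]) (fun n => by linarith [hw1 n]) Φ hKtop hkin
  have hb : Tendsto (fun n => L + w (κ n)) atTop (𝓝 L) := by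
    have := (hw0.comp hκ.tendsto_atTop).const_add L
    rwa [add_zero] at this
  have hbb : ∀ n, L ≤ L + w (κ n) := fun n => by linarith [hwpos (κ n)]
  have h0 : ∀ (p : Fin N × Fin 3) (n : ℕ) (X : Config N), L + w (κ n) ≤ X p.1 p.2 →
      (Φ (κ n)).ψ X = 0 :=
    fun p n X hX => (Φ (κ n)).eq_zero X fun hbox => lt_irrefl _ ((hbox p.1 p.2).2.trans_le hX)
  -- the limit vanishes above `L` and obeys the weighted bounds
  have hzero : ∀ p : Fin N × Fin 3, ∀ᵐ X : Config N, L < X p.1 p.2 → f X = 0 := fun p =>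
    BoxFace.ae_eq_zero_of_tendsto_face (Φ := fun n => (Φ (κ n)).ψ) p hb (h0 p) hae
  have hW : ∀ p : Fin N × Fin 3, ∫⁻ X in {X : Config N | X p.1 p.2 ∈ Ioo (L - (L + 1)) L},
      ‖f X‖ₑ ^ 2 / ENNReal.ofReal ((L - X p.1 p.2) ^ 2) ≤ 4 * K := fun p =>
    BoxFace.lintegral_sq_div_sq_limit_le (fun n => (Φ (κ n)).contDiff) p hb hbb (h0 p) hae
      (fun n => (lintegral_mono fun X => enorm_fderiv_single_sq_le _ X p).trans (hkin (κ n))) (L + 1)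
  obtain ⟨δ, hδ0, hδ⟩ := collar_mass_le hL hzero (ENNReal.mul_ne_top (by norm_num) hKtop) hW
  -- collar masses of the limit
  set M : ℕ → ℝ≥0∞ := fun j => ∑ i : Fin N, ∑ k : Fin 3,
    ∫⁻ X in {X : Config N | L - w j < X i k}, ‖f X‖ₑ ^ 2 with hM_def
  have hMle : ∀ j, M j ≤ δ j := fun j => (hδ j).trans (by
    calc ENNReal.ofReal (w j ^ 2) * δ j ≤ 1 * δ j := by
          gcongr
          exact ENNReal.ofReal_le_one.2 (by nlinarith [hwpos j, hw1 j])
      _ = δ j := one_mul _)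
  have hM0 : Tendsto M atTop (𝓝 0) :=
    tendsto_of_tendsto_of_tendsto_of_le_of_le tendsto_const_nhds hδ0 (fun _ => bot_le) hMle
  -- Step A: fixed `α > 0` and `j`, limit `n → ∞` in the cut-down bound
  have hstep : ∀ α : ℝ, 0 < α → ∀ j : ℕ, E₀ * (1 - M j) ≤
      ENNReal.ofReal (1 + α) * Esup + ENNReal.ofReal ((1 + α⁻¹) * (Real.pi ^ 2 / 4)) * δ j := by
    intro α hα j
    set m : ℕ → ℝ≥0∞ := fun n => ∑ i : Fin N, ∑ k : Fin 3,
      ∫⁻ X in {X : Config N | L - w j < X i k}, ‖(Φ (κ n)).ψ X‖ₑ ^ 2 with hm_def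
    have hm : Tendsto m atTop (𝓝 (M j)) := by
      refine tendsto_finsetSum _ fun i _ => tendsto_finsetSum _ fun k _ => ?_
      exact BoxFace.tendsto_setLIntegral_sq
        (fun n => (Φ (κ n)).contDiff.continuous.aestronglyMeasurable) hf hL2 _
    have hcut : ∀ n, E₀ * (1 - m n) ≤ ENNReal.ofReal (1 + α) * energy v (Φ (κ n)) +
        ENNReal.ofReal ((1 + α⁻¹) * (Real.pi / (2 * w j)) ^ 2) * m n := fun n =>
      TopFaceCutoff.groundStateEnergy_mul_le v (hwpos j) hα (Φ (κ n))
    have hen : Tendsto (fun n => energy v (Φ (κ n))) atTop (𝓝 Esup) := by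
      have h1 : Tendsto (fun n => E (κ n)) atTop (𝓝 Esup) := hEtend.comp hκ.tendsto_atTop
      have h2 : Tendsto (fun n => E (κ n) + ENNReal.ofReal (w (κ n))) atTop (𝓝 Esup) := by
        have := h1.add (ENNReal.tendsto_ofReal (hw0.comp hκ.tendsto_atTop))
        rwa [ENNReal.ofReal_zero, add_zero] at this
      exact tendsto_of_tendsto_of_tendsto_of_le_of_le h1 h2
        (fun n => groundStateEnergy_le_energy v _) (fun n => hΦ (κ n))
    have hlim_l : Tendsto (fun n => E₀ * (1 - m n)) atTop (𝓝 (E₀ * (1 - M j))) :=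
      ENNReal.Tendsto.const_mul (ENNReal.Tendsto.sub tendsto_const_nhds hm (Or.inl ENNReal.one_ne_top))
        (Or.inr hfin)
    have hlim_r : Tendsto (fun n => ENNReal.ofReal (1 + α) * energy v (Φ (κ n)) +
        ENNReal.ofReal ((1 + α⁻¹) * (Real.pi / (2 * w j)) ^ 2) * m n) atTop
        (𝓝 (ENNReal.ofReal (1 + α) * Esup +
          ENNReal.ofReal ((1 + α⁻¹) * (Real.pi / (2 * w j)) ^ 2) * M j)) :=
      (ENNReal.Tendsto.const_mul hen (Or.inr ENNReal.ofReal_ne_top)).add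
        (ENNReal.Tendsto.const_mul hm (Or.inr ENNReal.ofReal_ne_top))
    refine (le_of_tendsto_of_tendsto' hlim_l hlim_r hcut).trans (add_le_add le_rfl ?_)
    calc ENNReal.ofReal ((1 + α⁻¹) * (Real.pi / (2 * w j)) ^ 2) * M j
        ≤ ENNReal.ofReal ((1 + α⁻¹) * (Real.pi / (2 * w j)) ^ 2) * (ENNReal.ofReal (w j ^ 2) * δ j) :=
          mul_le_mul_right (hδ j) _
      _ = ENNReal.ofReal ((1 + α⁻¹) * (Real.pi ^ 2 / 4)) * δ j := by
          rw [← mul_assoc, ← ENNReal.ofReal_mul (by positivity)]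
          congr 2
          have hwj : w j ≠ 0 := (hwpos j).ne'
          field_simp
          norm_num
  -- Step B: `j → ∞` gives `E₀ ≤ (1+α) Esup`
  have hB : ∀ α : ℝ, 0 < α → E₀ ≤ ENNReal.ofReal (1 + α) * Esup := by
    intro α hα
    have hl : Tendsto (fun j => E₀ * (1 - M j)) atTop (𝓝 (E₀ * (1 - 0))) :=
      ENNReal.Tendsto.const_mul (ENNReal.Tendsto.sub tendsto_const_nhds hM0 (Or.inl ENNReal.one_ne_top))
        (Or.inr hfin)
    rw [tsub_zero, mul_one] at hl
    have hr : Tendsto (fun j => ENNReal.ofReal (1 + α) * Esup +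
        ENNReal.ofReal ((1 + α⁻¹) * (Real.pi ^ 2 / 4)) * δ j) atTop
        (𝓝 (ENNReal.ofReal (1 + α) * Esup + ENNReal.ofReal ((1 + α⁻¹) * (Real.pi ^ 2 / 4)) * 0)) :=
      tendsto_const_nhds.add (ENNReal.Tendsto.const_mul hδ0 (Or.inr ENNReal.ofReal_ne_top))
    rw [mul_zero, add_zero] at hr
    exact le_of_tendsto_of_tendsto' hl hr (hstep α hα)
  -- Step C: `α → 0`
  have hC : Tendsto (fun j : ℕ => ENNReal.ofReal (1 + w j) * Esup) atTop (𝓝 Esup) := by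
    have h1 : Tendsto (fun j : ℕ => ENNReal.ofReal (1 + w j)) atTop (𝓝 1) := by
      have := ENNReal.tendsto_ofReal (hw0.const_add 1)
      rwa [add_zero, ENNReal.ofReal_one] at this
    have := ENNReal.Tendsto.mul_const h1 (Or.inl one_ne_zero) (b := Esup)
    rwa [one_mul] at this
  exact ge_of_tendsto' hC fun j => hB (w j) (hwpos j)

/-- **Right-continuity of the Dirichlet ground-state energy in the box side.** For every pair
potential `v : ℝ → [0, ∞]`, every `N`, every `L > 0` with `E₀(N, L) < ∞` and every `η > 0` there is
`w₀ > 0` such that `E₀(N, L) ≤ E₀(N, L + w) + η` for all `0 < w < w₀`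
(`groundStateEnergy_le_iSup_enlarge` and antitonicity `groundStateEnergy_anti`). [folklore] -/
theorem groundStateEnergy_rightContinuous (v : ℝ → ℝ≥0∞) (N : ℕ) {L : ℝ} (hL : 0 < L)
    (hfin : groundStateEnergy v N L ≠ ⊤) {η : ℝ} (hη : 0 < η) :
    ∃ w₀ : ℝ, 0 < w₀ ∧ ∀ w : ℝ, 0 < w → w < w₀ →
      groundStateEnergy v N L ≤ groundStateEnergy v N (L + w) + ENNReal.ofReal η := by
  by_cases hsmall : groundStateEnergy v N L ≤ ENNReal.ofReal η
  · exact ⟨1, one_pos, fun w _ _ => hsmall.trans le_add_self⟩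
  · have hne : groundStateEnergy v N L ≠ 0 := fun h0 => hsmall (by rw [h0]; exact bot_le)
    have hlt : groundStateEnergy v N L - ENNReal.ofReal η < groundStateEnergy v N L :=
      ENNReal.sub_lt_self hfin hne (ENNReal.ofReal_pos.2 hη).ne'
    obtain ⟨n, hn⟩ := lt_iSup_iff.1 (hlt.trans_le (groundStateEnergy_le_iSup_enlarge v N hL hfin))
    refine ⟨1 / ((n : ℝ) + 1), by positivity, fun w _ hwn => ?_⟩
    calc groundStateEnergy v N L
        ≤ groundStateEnergy v N L - ENNReal.ofReal η + ENNReal.ofReal η := le_tsub_add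
      _ ≤ groundStateEnergy v N (L + 1 / ((n : ℝ) + 1)) + ENNReal.ofReal η := add_le_add hn.le le_rfl
      _ ≤ groundStateEnergy v N (L + w) + ENNReal.ofReal η :=
          add_le_add (groundStateEnergy_anti v N (by linarith)) le_rfl

end Literature.MathematicalPhysics.QuantumManyBody.BoseGas

end
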